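import Summits.Ventures.DiscreteObjects.Hadamard.ConferenceGraph333TwoCells
import Summits.Ventures.DiscreteObjects.Hadamard.ClassSumTrace

/-!
# Involutions of srg(333,166,82,83) fix `f ≡ 1 (mod 4)` vertices (kernel; second census line)

Framing: lottery ticket; floor = certified bounds/negative ranges.  Cell pub-namedobj (venture DiscreteObjects),
target (H) = `H(668)`, hadamard gen 28; companion of `ConferenceGraph333Order3` (order 3: `f ≡ 3 (mod 6)`).
* `mem_orb2_iff` — orbits `{x, σx}` of an involution as finsets;
* **`involution_fixedPoints_mod_four`** — for the adjacency matrix `A` of an `srg(333,166,82,83)` (hypotheses of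
  `ConferenceGraph333`) and a permutation `σ` with `σ² = 1` preserving adjacency, the number `f` of fixed points
  satisfies **`f ≡ 1 (mod 4)`**: the `σ`-orbits are an equitable partition of the Seidel matrix `S`, the class-sum
  matrix has `Σ_i R_{ii} = 0` (`ClassSumTrace`), fixed points contribute `0` and each `2`-orbit `{x, σx}` contributes
  `R_{ii} = S_{x,σx} = ±1`, so the number `m` of `2`-orbits is even and `333 = f + 2m` gives `f ≡ 1 (mod 4)`.
  (For `σ = 1`, `f = 333 ≡ 1`.)  In words: an involution of a symmetric `C(334)` fixing the border point fixes
  `1 (mod 4)` of the other `333` points; e.g. it cannot fix exactly `3` points or act with `f = 111`.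
Ours (instance; method = orbit matrices + the trace condition); `srg(333,166,82,83)`, `C(334)`, `H(668)` untouched.
No `sorry`, no new definitions.
-/

namespace Summit.Ventures.DiscreteObjects.Hadamard

open Finset

/-- `333` is not a square (private copy; the public lemma lives in `ConferenceGraph333Order3`). -/
private theorem not_isSquare_333' : ¬ IsSquare (333 : ℕ) := by
  rintro ⟨r, hr⟩
  have : r ≤ 19 := by nlinarith
  interval_cases r <;> omega

section involution
variable {V : Type*} [Fintype V] [DecidableEq V]

omit [Fintype V] in
/-- The orbit `{x, σx}` of an involution as a `Finset`; membership is 'same orbit'. -/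
theorem mem_orb2_iff (σ : Equiv.Perm V) (hσ : ∀ x, σ (σ x) = x) (x y : V) :
    y ∈ ({x, σ x} : Finset V) ↔ ({y, σ y} : Finset V) = {x, σ x} := by
  constructor
  · intro hy
    simp only [Finset.mem_insert, Finset.mem_singleton] at hy
    rcases hy with rfl | rfl
    · rfl
    · rw [hσ]; ext z; simp only [Finset.mem_insert, Finset.mem_singleton]; tauto
  · intro h
    rw [← h]
    simp

/-- **Involutions of `srg(333,166,82,83)` fix `1 (mod 4)` points.** -/
theorem involution_fixedPoints_mod_four (hV : Fintype.card V = 333) (A : Matrix V V ℤ)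
    (h01 : ∀ x y, A x y = 0 ∨ A x y = 1) (hsymm : ∀ x y, A y x = A x y) (hdiag : ∀ x, A x x = 0)
    (hk : ∀ x, ∑ y, A x y = 166) (hsrg : ∀ x y, ∑ z, A x z * A z y = 83 * (1 + (if x = y then 1 else 0)) - A x y)
    (σ : Equiv.Perm V) (hσ : ∀ x, σ (σ x) = x) (hA : ∀ x y, A (σ x) (σ y) = A x y) :
    (univ.filter fun x => σ x = x).card % 4 = 1 := by
  classical
  obtain ⟨hSd, hSo, hSs, hS1, hSS⟩ := seidel_identities_of_conferenceGraph A h01 hsymm hdiag 83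
    (by rw [hV]; norm_num) (fun x => by rw [hk x]; norm_num) hsrg
  set S : V → V → ℤ := fun x y => 1 - (if x = y then 1 else 0) - 2 * A x y with hS_def
  have hSS' : ∀ x y, ∑ z, S x z * S z y = 333 * (if x = y then 1 else 0) - 1 := fun x y => by
    rw [hSS x y, hV]; norm_num
  have hSσ : ∀ x y, S (σ x) (σ y) = S x y := fun x y => by
    simp only [hS_def, hA, σ.injective.eq_iff]
  have hSd' : ∀ x, S x x = 0 := fun x => hSd x
  have hSo' : ∀ x y, x ≠ y → S x y = 1 ∨ S x y = -1 := fun x y => hSo x y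
  -- orbits as finsets
  set orb : V → Finset V := fun x => {x, σ x} with horb_def
  have horb_mem : ∀ x y, y ∈ orb x ↔ orb y = orb x := fun x y => mem_orb2_iff σ hσ x y
  have horb_σ : ∀ y, orb (σ y) = orb y := fun y => (horb_mem y (σ y)).mp (by simp [horb_def])
  set ι := {j : Finset V // j ∈ univ.image orb} with hι_def
  set cls : V → ι := fun x => ⟨orb x, Finset.mem_image_of_mem _ (Finset.mem_univ x)⟩ with hcls_def
  have hcls_eq : ∀ x y, cls y = cls x ↔ orb y = orb x := fun x y => by
    rw [hcls_def, Subtype.mk.injEq]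
  have hcls_σ : ∀ y, cls (σ y) = cls y := fun y => (hcls_eq y (σ y)).mpr (horb_σ y)
  have hcell : ∀ x, (univ.filter fun y => cls y = cls x) = orb x := by
    intro x; ext y
    rw [Finset.mem_filter, hcls_eq, ← horb_mem]
    simp
  have hrep : ∀ i : ι, ∃ x, cls x = i := by
    rintro ⟨j, hj⟩
    obtain ⟨x, -, hx⟩ := Finset.mem_image.mp hj
    exact ⟨x, Subtype.ext hx⟩
  choose rep hrep using hrep
  set R : Matrix ι ι ℤ := fun i j => ∑ y ∈ univ.filter (fun y => cls y = j), S (rep i) y with hR_def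
  have hshift : ∀ r (j : ι), ∑ y ∈ univ.filter (fun y => cls y = j), S (σ r) y =
      ∑ y ∈ univ.filter (fun y => cls y = j), S r y := by
    intro r j
    rw [Finset.sum_filter, Finset.sum_filter]
    exact Fintype.sum_equiv σ.symm _ _ fun y => by
      rw [show cls y = cls (σ (σ.symm y)) by rw [Equiv.apply_symm_apply], hcls_σ,
        show S (σ r) y = S (σ r) (σ (σ.symm y)) by rw [Equiv.apply_symm_apply], hSσ]
  have key : ∀ (r x' : V) (j : ι), x' ∈ orb r →
      ∑ y ∈ univ.filter (fun y => cls y = j), S x' y = ∑ y ∈ univ.filter (fun y => cls y = j), S r y := by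
    intro r x' j hx'
    simp only [horb_def, Finset.mem_insert, Finset.mem_singleton] at hx'
    rcases hx' with rfl | rfl
    · rfl
    · exact hshift r j
  have hR : ∀ x j, ∑ y ∈ univ.filter (fun y => cls y = j), S x y = R (cls x) j := by
    intro x j
    have hx : x ∈ orb (rep (cls x)) := by rw [horb_mem, ← hcls_eq, hrep]
    exact key _ _ j hx
  have hids := fun i k => seidel333_classSum_identities S hSs hS1 hSS' cls R hR i k (rep i) (hrep i)
  have htr : ∑ i, R i i = 0 := by
    refine classSum_trace_zero R 333 not_isSquare_333' (fun k => ((univ.filter fun y => cls y = k).card : ℤ))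
      (fun i => (hids i i).1) fun i k => ?_
    rw [(hids i k).2.1]
    push_cast
    ring
  have hdiagR : ∀ i, R i i = if σ (rep i) = rep i then 0 else S (rep i) (σ (rep i)) := by
    intro i
    have h0 : R i i = ∑ y ∈ orb (rep i), S (rep i) y := by
      rw [hR_def]; simp only; rw [← hcell (rep i), hrep]
    rw [h0, horb_def]
    simp only
    split_ifs with hfix
    · rw [hfix, Finset.insert_eq_of_mem (by simp), Finset.sum_singleton]
      exact hSd' _
    · have h1 : rep i ≠ σ (rep i) := fun h => hfix h.symm
      rw [Finset.sum_pair h1, hSd', zero_add]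
  set T := (univ : Finset ι).filter (fun i => σ (rep i) ≠ rep i) with hT_def
  have hTeven : 2 ∣ T.card := by
    have hsumT : ∑ i ∈ T, S (rep i) (σ (rep i)) = 0 := by
      have h := htr
      rw [Finset.sum_congr rfl fun i _ => hdiagR i, Finset.sum_ite, Finset.sum_const_zero, zero_add] at h
      rw [hT_def]; convert h using 2
    have hcast : ((∑ i ∈ T, S (rep i) (σ (rep i)) : ℤ) : ZMod 2) = (T.card : ZMod 2) := by
      rw [Int.cast_sum, Finset.card_eq_sum_ones, Nat.cast_sum]
      refine Finset.sum_congr rfl fun i hi => ?_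
      have hne : rep i ≠ σ (rep i) := fun h => (Finset.mem_filter.mp hi).2 h.symm
      rcases hSo' (rep i) (σ (rep i)) hne with h | h <;> rw [h] <;> decide
    rw [hsumT, Int.cast_zero] at hcast
    exact (ZMod.natCast_eq_zero_iff _ 2).mp hcast.symm
  have horb_card : ∀ i, (orb (rep i)).card = if σ (rep i) = rep i then 1 else 2 := by
    intro i
    rw [horb_def]; simp only
    split_ifs with hfix
    · rw [hfix]; simp
    · exact Finset.card_pair fun h => hfix h.symm
  have horb_fixed : ∀ i, ((orb (rep i)).filter fun y => σ y = y).card = if σ (rep i) = rep i then 1 else 0 := by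
    intro i
    rw [horb_def]; simp only
    split_ifs with hfix
    · rw [hfix, Finset.insert_eq_of_mem (by simp), Finset.filter_singleton, if_pos hfix, Finset.card_singleton]
    · have hn1 : ¬ σ (σ (rep i)) = σ (rep i) := fun h => hfix (σ.injective h)
      rw [Finset.card_eq_zero, Finset.filter_eq_empty_iff]
      intro y hy
      simp only [Finset.mem_insert, Finset.mem_singleton] at hy
      rcases hy with rfl | rfl
      · exact hfix
      · exact hn1
  have h333 : (333 : ℕ) = ∑ i : ι, (orb (rep i)).card := by
    rw [← hV, ← Finset.card_univ, Finset.card_eq_sum_card_fiberwise (f := cls) (t := univ)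
      fun _ _ => Finset.mem_univ _]
    exact Finset.sum_congr rfl fun i _ => by rw [← hrep i, hcell, hrep]
  have hf : (univ.filter fun x => σ x = x).card = ∑ i : ι, ((orb (rep i)).filter fun y => σ y = y).card := by
    rw [Finset.card_eq_sum_card_fiberwise (f := cls) (s := univ.filter fun x => σ x = x) (t := univ)
      fun _ _ => Finset.mem_univ _]
    refine Finset.sum_congr rfl fun i _ => congrArg Finset.card ?_
    ext y
    rw [Finset.mem_filter, Finset.mem_filter, Finset.mem_filter, ← hcell (rep i), Finset.mem_filter, hrep]
    tauto
  rw [Finset.sum_congr rfl fun i _ => horb_card i, Finset.sum_ite, Finset.sum_const, Finset.sum_const] at h333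
  rw [Finset.sum_congr rfl fun i _ => horb_fixed i, Finset.sum_ite, Finset.sum_const, Finset.sum_const] at hf
  simp only [smul_eq_mul, mul_one, mul_zero, add_zero] at h333 hf
  have hTc : (univ.filter fun i : ι => ¬ σ (rep i) = rep i).card = T.card := by rw [hT_def]
  rw [hTc] at h333
  obtain ⟨m, hm⟩ := hTeven
  omega

end involution

end Summit.Ventures.DiscreteObjects.Hadamard
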